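import Mathlib
import HarnessLib
import Literature.Computability.AlgebraicComplexity.SymmetricArithCircuit
import Literature.Computability.AlgebraicComplexity.DawarWilsenach2025Proofs
import Literature.Computability.AlgebraicComplexity.MonotoneStructure
import Summits.ValiantsHypothesis.ValiantsHypothesis.Theorems.MonotoneRestorationMonotoneRestorationQPGateSupport
import Summits.ValiantsHypothesis.ValiantsHypothesis.Theorems.MonotoneRestorationMonotoneRestorationQPAltOrbitDichotomy
import Summits.ValiantsHypothesis.ValiantsHypothesis.Theorems.MonotoneRestorationMonotoneRestorationQPMulGateChildren
import Summits.ValiantsHypothesis.ValiantsHypothesis.Theorems.MonotoneRestorationMonotoneRestorationQPGammaShadows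

/-!
# ValiantsHypothesis / MonotoneRestoration — `MonotoneRestorationQP`, line `Sketch`, stub H2

Support file for crux item `stmt-ValiantsHypothesis-15886`
(`Summit.ValiantsHypothesis.ValiantsHypothesis.Theses.MonotoneRestoration.MonotoneRestorationQP`),
line `Sketch`, stub `stub_gammaDroppingGate` (the heart of Theorem γ: analysis of a degree-dropping
multiplication gate of a `Sym_n`-symmetric circuit over `ℝ≥0`).

Setting: a `Sym_n`-symmetric labelled circuit `C` over the semiring `ℝ≥0` on the matrix of
variables `x_{ij}`, whose output `f` is homogeneous of degree `d` and ROW-MULTILINEAR (every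
monomial uses every row at most once); a `×` gate `P` with `eval P ≠ 0` homogeneous of degree
`D ≥ k`, a nonzero context `Q` with `Q · eval P ≤ f` supportwise, and all children of `P` of
degree `< D`.

Write `rows m` for the set of rows used by a monomial `m` and `shadow p = ⋃_{m ∈ supp p} rows m`.

* (0) Over `ℝ≥0` nothing cancels (`add_mem_support_mul`, G3 `stub_mulGate_children_extend`):
  every child `c` of `P` is nonzero, homogeneous of its total degree `D_c`, row-multilinear, the
  `D_c` sum to `D`, and the shadows of two different children are disjoint (a common row would be
  used twice in a monomial of `f`).
* (1) G1 (`stub_gateSupport`) gives a set `X` of `< k` indices such that every even permutation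
  fixing `X` pointwise extends to an automorphism fixing `P`; such automorphisms permute the
  children of `P`, so (2) by G2 (`stub_altFixing_orbit_dichotomy`, the orbit of a non-constant
  child lies among the `≤ D < n - |X|` non-constant children) every child is invariant under the
  even permutations fixing `X`.
* (3) An invariant polynomial whose shadow leaves `X` has all of `[n] ∖ X` in its shadow (even
  permutations fixing `X` are transitive on the complement). By disjointness at most one child is
  "big" in this sense; every other child `c` has `shadow ⊆ X`, hence `D_c ≤ |shadow c|`, and these
  shadows are disjoint subsets of `X`: their degrees sum to `≤ |X| ≤ k - 1 < k ≤ D`, so a big child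
  `c⋆` exists and `D ≤ D_{c⋆} + (k - 1)`.
* (4) Output `c⋆`, `q = ∏_{c ≠ c⋆} eval c` (`eval P = eval c⋆ · q`), `D' = D_{c⋆}`. The rows of a
  monomial of `Q`, of one of `q` and of one of `eval c⋆` are pairwise disjoint (their sum is a
  monomial of `f`); the rows of `eval c⋆` cover `[n] ∖ X`, so `shadow Q ⊆ X`, `shadow q ⊆ X`,
  `shadow Q ∩ shadow q = ∅`, `shadow q ≠ ∅` (`deg q = D - D' ≥ 1`), and
  `shadow (Q q) = shadow Q ∪ shadow q`; the two cardinality bounds follow.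

The generic "row shadow" lemmas (shadows are always spelled out as
`p.support.biUnion fun m => (rowDegrees m).support`; `gammaDrop_rows_add`,
`gammaDrop_shadow_mul_subset`, `gammaDrop_compl_subset_shadow`, …) live in
`MonotoneRestorationMonotoneRestorationQPGammaShadows.lean`; `gamma_diag_injective`,
`gamma_degree_eq_card_rows` and `gamma_exists_threeCycle` are reused from
`MonotoneRestorationMonotoneRestorationQPChooseLeCard.lean`.
-/

-- `Summit.ValiantsHypothesis.ValiantsHypothesis.…` is the tree's mandated single-conjunct layout
-- (Sub = Summit), so the duplicated namespace component is intended.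
set_option linter.dupNamespace false

noncomputable section

namespace Summit.ValiantsHypothesis.ValiantsHypothesis.Theorems

open Literature.Computability.AlgebraicComplexity MvPolynomial
open scoped NNReal Pointwise

/-! ### The children of a multiplication gate -/

/-- The children of a nonzero `×` gate are nonzero. [folklore] -/
theorem gammaDrop_child_ne_zero {n : ℕ} {G : Type}
    (C : LabelledArithCircuit NNReal (Fin n × Fin n) Unit G) {P : G} (hP : C.label P = .mul)
    (hP0 : C.eval P ≠ 0) {c : G} (hc : c ∈ C.children P) : C.eval c ≠ 0 := by
  intro h0
  apply hP0
  rw [C.eval_of_label_mul hP]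
  exact Finset.prod_eq_zero hc h0

/-- At a nonzero `×` gate homogeneous of degree `D` whose children are homogeneous of their total
degrees, the total degrees of the children sum to `D`. [folklore] -/
theorem gammaDrop_sum_totalDegree_children {n : ℕ} {G : Type}
    (C : LabelledArithCircuit NNReal (Fin n × Fin n) Unit G) {P : G} (hP : C.label P = .mul)
    (hP0 : C.eval P ≠ 0) {D : ℕ} (hPhom : (C.eval P).IsHomogeneous D)
    (hhom : ∀ c ∈ C.children P, (C.eval c).IsHomogeneous (C.eval c).totalDegree) :
    ∑ c ∈ C.children P, (C.eval c).totalDegree = D := by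
  have h := IsHomogeneous.prod (C.children P) (fun c => C.eval c)
    (fun c => (C.eval c).totalDegree) hhom
  rw [← C.eval_of_label_mul hP] at h
  exact h.inj_right hPhom hP0

/-- **Invariance of the children of a supported gate.** If every even permutation fixing `X`
pointwise extends to an automorphism fixing the gate `P`, the children of `P` are homogeneous of
their total degrees, and these degrees sum to less than `n - |X|`, then every child of `P` is
fixed (as a polynomial, under the diagonal renaming) by every even permutation fixing `X`:
constant children trivially (`rename_C`), and the orbit of a non-constant child stays among the
values of the at most `Σ_c D_c` non-constant children (automorphisms permute the children,
`IsAutomorphismExtending.children_apply`/`eval_apply`), so G2 (`stub_altFixing_orbit_dichotomy`)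
applies. [new] -/
theorem gammaDrop_children_invariant {n : ℕ} {G : Type}
    (C : LabelledArithCircuit NNReal (Fin n × Fin n) Unit G) {P : G}
    (X : Finset (Fin n)) (h9 : X.card + 9 ≤ n)
    (hfix : ∀ ρ : Equiv.Perm (Fin n), (∀ x ∈ X, ρ x = x) → Equiv.Perm.sign ρ = 1 →
      ∃ π : Equiv.Perm G, C.IsAutomorphismExtending ρ π ∧ π P = P)
    (hhom : ∀ c ∈ C.children P, (C.eval c).IsHomogeneous (C.eval c).totalDegree)
    (hlt : (∑ c ∈ C.children P, (C.eval c).totalDegree) + X.card < n)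
    {c : G} (hc : c ∈ C.children P) (ρ : Equiv.Perm (Fin n)) (hρX : ∀ x ∈ X, ρ x = x)
    (hρs : Equiv.Perm.sign ρ = 1) :
    rename (fun x : Fin n × Fin n => (ρ x.1, ρ x.2)) (C.eval c) = C.eval c := by
  classical
  by_cases h0 : (C.eval c).IsHomogeneous 0
  · have hC : C.eval c = MvPolynomial.C (coeff 0 (C.eval c)) :=
      totalDegree_eq_zero_iff_eq_C.1 ((totalDegree_zero_iff_isHomogeneous _).2 h0)
    rw [hC, rename_C]
  -- the orbit of `eval c` stays among the values of the non-constant children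
  set F : Finset G := (C.children P).filter fun c' => ¬ (C.eval c').IsHomogeneous 0 with hF_def
  set T : Finset (MvPolynomial (Fin n × Fin n) NNReal) := F.image C.eval with hT_def
  have hFcard : F.card ≤ ∑ c' ∈ C.children P, (C.eval c').totalDegree := by
    calc F.card = ∑ c' ∈ F, 1 := Finset.card_eq_sum_ones F
      _ ≤ ∑ c' ∈ F, (C.eval c').totalDegree := by
        refine Finset.sum_le_sum fun c' hc' => ?_
        obtain ⟨hc'P, hc'0⟩ := Finset.mem_filter.1 hc'
        have hpos : (C.eval c').totalDegree ≠ 0 := by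
          intro hz
          have key := hhom c' hc'P
          rw [hz] at key
          exact hc'0 key
        exact Nat.one_le_iff_ne_zero.2 hpos
      _ ≤ ∑ c' ∈ C.children P, (C.eval c').totalDegree :=
        Finset.sum_le_sum_of_subset (Finset.filter_subset _ _)
  have hT : T.card + X.card < n :=
    calc T.card + X.card ≤ F.card + X.card := Nat.add_le_add_right Finset.card_image_le _
      _ < n := by omega
  refine stub_altFixing_orbit_dichotomy (C.eval c) X h9 T hT ?_ ρ hρX hρs
  intro τ hτX hτs
  obtain ⟨π, hπ, hπP⟩ := hfix τ hτX hτs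
  have hπc : π c ∈ C.children P := by
    have key := hπ.children_apply P
    rw [hπP] at key
    rw [key]
    exact Finset.mem_map.2 ⟨c, hc, rfl⟩
  have heval : C.eval (π c) = rename (fun x : Fin n × Fin n => (τ x.1, τ x.2)) (C.eval c) :=
    hπ.eval_apply c
  refine Finset.mem_image.2 ⟨π c, Finset.mem_filter.2 ⟨hπc, ?_⟩, heval⟩
  rw [heval, IsHomogeneous.rename_isHomogeneous_iff (gamma_diag_injective τ)]
  exact h0

/-- **The big child.** Abstract core of step (3): children `c ∈ S` with values `e c` of total
degrees `D_c` summing to `D ≥ k > |X|`, each `D_c` at most the size of the shadow of `e c`,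
pairwise disjoint shadows, and the filling property (a shadow meeting `[n] ∖ X` contains
`[n] ∖ X`). Then there is a child `c₀` whose shadow contains `[n] ∖ X`, every other child has its
shadow inside `X`, and `D ≤ D_{c₀} + |X|`. [new] -/
theorem gammaDrop_big_child {n : ℕ} {G : Type} (S : Finset G)
    (e : G → MvPolynomial (Fin n × Fin n) NNReal) (X : Finset (Fin n)) {k D : ℕ}
    (hXk : X.card < k) (hkD : k ≤ D) (hD : ∑ c ∈ S, (e c).totalDegree = D)
    (hdeg : ∀ c ∈ S,
      (e c).totalDegree ≤ ((e c).support.biUnion fun m => (rowDegrees m).support).card)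
    (hdisj : ∀ c ∈ S, ∀ c' ∈ S, c ≠ c' →
      Disjoint ((e c).support.biUnion fun m => (rowDegrees m).support)
        ((e c').support.biUnion fun m => (rowDegrees m).support))
    (hfill : ∀ c ∈ S, ∀ i₀ ∉ X, i₀ ∈ ((e c).support.biUnion fun m => (rowDegrees m).support) →
      ∀ i ∉ X, i ∈ ((e c).support.biUnion fun m => (rowDegrees m).support)) :
    ∃ c₀ ∈ S, (∀ i ∉ X, i ∈ ((e c₀).support.biUnion fun m => (rowDegrees m).support)) ∧
      (∀ c ∈ S, c ≠ c₀ → ((e c).support.biUnion fun m => (rowDegrees m).support) ⊆ X) ∧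
      D ≤ (e c₀).totalDegree + X.card := by
  classical
  -- degrees of children living on `X` add up to at most `|X|`
  have hsmall : ∀ S' ⊆ S,
      (∀ c ∈ S', ((e c).support.biUnion fun m => (rowDegrees m).support) ⊆ X) →
      ∑ c ∈ S', (e c).totalDegree ≤ X.card := by
    intro S' hS' hX'
    calc ∑ c ∈ S', (e c).totalDegree
        ≤ ∑ c ∈ S', ((e c).support.biUnion fun m => (rowDegrees m).support).card :=
          Finset.sum_le_sum fun c hc => hdeg c (hS' hc)
      _ = (S'.biUnion fun c => ((e c).support.biUnion fun m => (rowDegrees m).support)).card := by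
          rw [Finset.card_biUnion]
          intro c hc c' hc' hcc'
          exact hdisj c (hS' (Finset.mem_coe.1 hc)) c' (hS' (Finset.mem_coe.1 hc')) hcc'
      _ ≤ X.card := Finset.card_le_card (Finset.biUnion_subset.2 fun c hc => hX' c hc)
  -- hence some child leaves `X`
  have hex : ∃ c₀ ∈ S, ¬ ((e c₀).support.biUnion fun m => (rowDegrees m).support) ⊆ X := by
    by_contra hall
    have hall' : ∀ c ∈ S, ((e c).support.biUnion fun m => (rowDegrees m).support) ⊆ X :=
      fun c hc => by_contra fun h => hall ⟨c, hc, h⟩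
    have key := hsmall S (Finset.Subset.refl _) hall'
    omega
  obtain ⟨c₀, hc₀, hnot⟩ := hex
  obtain ⟨i₀, hi₀, hi₀X⟩ := Finset.not_subset.1 hnot
  have hbig : ∀ i ∉ X, i ∈ ((e c₀).support.biUnion fun m => (rowDegrees m).support) :=
    hfill c₀ hc₀ i₀ hi₀X hi₀
  -- and it is the only one
  have hothers : ∀ c ∈ S, c ≠ c₀ →
      ((e c).support.biUnion fun m => (rowDegrees m).support) ⊆ X := by
    intro c hc hcc₀
    by_contra hnot'
    obtain ⟨i₁, hi₁, hi₁X⟩ := Finset.not_subset.1 hnot'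
    exact Finset.disjoint_left.1 (hdisj c hc c₀ hc₀ hcc₀) hi₁ (hbig i₁ hi₁X)
  refine ⟨c₀, hc₀, hbig, hothers, ?_⟩
  have h1 := Finset.add_sum_erase S (fun c => (e c).totalDegree) hc₀
  have h2 := hsmall (S.erase c₀) (Finset.erase_subset _ _) fun c hc =>
    hothers c (Finset.mem_of_mem_erase hc) (Finset.ne_of_mem_erase hc)
  omega

/-- **H2 — the dropping gate (heart of Theorem γ).** In a `Sym_n`-symmetric labelled circuit over
`ℝ≥0` with fewer than `C(n,k)` gates whose output `f` is homogeneous of degree `d` and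
row-multilinear, let `P` be a nonzero `×` gate, homogeneous of degree `D ≥ k`, with a nonzero
context `Q` (`Q · eval P ≤ f` supportwise) and all children of degree `< D`. By G1 (support `X_P`,
`|X_P| < k`), G2 (children are `Alt([n] ∖ X_P)`-invariant) and G3 with row-multilinearity
(children have pairwise row-disjoint, context-disjoint shadows), and since `|X_P| < k ≤ D`
(transitivity of `Alt` on `[n] ∖ X_P`) all children but one, `c`, have their rows inside `X_P`:
with `q` the product of the other children, `eval P = eval c · q`, `deg q ≤ |X_P| ≤ k - 1`,
`deg q ≥ 1` (dropping), and the rows of `Q` and of `q` are disjoint, nonempty for `q`, and all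
inside `X_P` (they avoid the rows of `c`, which cover `[n] ∖ X_P`). Output: the child `c`, the new
context `Q · q`, and the bookkeeping. [new] -/
theorem stub_gammaDroppingGate {n : ℕ} {G : Type} [Fintype G]
    (C : LabelledArithCircuit NNReal (Fin n × Fin n) Unit G)
    (hC : C.IsSymmetric (Equiv.Perm (Fin n))) {d k D : ℕ}
    (hn : 8 < n) (hk : 2 ≤ k) (h4k : 4 * k ≤ n) (hdk : d + k + 9 ≤ n)
    (hcard : Fintype.card G < n.choose k)
    (hfhom : (C.eval (C.output ())).IsHomogeneous d)
    (hrow : ∀ m ∈ (C.eval (C.output ())).support, ∀ i : Fin n, rowDegrees m i ≤ 1)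
    (Q : MvPolynomial (Fin n × Fin n) NNReal) (hQ : Q ≠ 0)
    (P : G) (hP : C.label P = .mul) (hP0 : C.eval P ≠ 0) (hPhom : (C.eval P).IsHomogeneous D)
    (hkD : k ≤ D)
    (hext : ∀ a ∈ Q.support, ∀ m ∈ (C.eval P).support, a + m ∈ (C.eval (C.output ())).support)
    (hdrop : ∀ c ∈ C.children P, (C.eval c).totalDegree < D) :
    ∃ (c : G) (q : MvPolynomial (Fin n × Fin n) NNReal) (D' : ℕ),
      C.eval c ≠ 0 ∧ (C.eval c).IsHomogeneous D' ∧ D ≤ D' + (k - 1) ∧ Q * q ≠ 0 ∧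
      (∀ a ∈ (Q * q).support, ∀ m ∈ (C.eval c).support,
        a + m ∈ (C.eval (C.output ())).support) ∧
      (Q.support.biUnion fun m => (rowDegrees m).support).card + 1 ≤
        ((Q * q).support.biUnion fun m => (rowDegrees m).support).card ∧
      ((Q * q).support.biUnion fun m => (rowDegrees m).support).card ≤ k - 1 := by
  classical
  -- (0) basic facts about the children of `P`
  obtain ⟨a₀, ha₀⟩ := support_nonempty.2 hQ
  have hextP : ∃ μ : (Fin n × Fin n) →₀ ℕ, ∀ m ∈ (C.eval P).support,
      m + μ ∈ (C.eval (C.output ())).support :=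
    ⟨a₀, fun m hm => by rw [add_comm]; exact hext a₀ ha₀ m hm⟩
  obtain ⟨hch1, hch2⟩ := stub_mulGate_children_extend C (C.eval (C.output ())) hP hP0 hextP
  have hc0 : ∀ c ∈ C.children P, C.eval c ≠ 0 := fun c hc => gammaDrop_child_ne_zero C hP hP0 hc
  have hchom : ∀ c ∈ C.children P, (C.eval c).IsHomogeneous (C.eval c).totalDegree := by
    intro c hc
    obtain ⟨μ, hμ⟩ := hch1 c hc
    exact gammaDrop_isHomogeneous_of_extend hfhom hμ
  have hcrow : ∀ c ∈ C.children P, ∀ m ∈ (C.eval c).support, ∀ i, rowDegrees m i ≤ 1 := by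
    intro c hc m hm i
    obtain ⟨μ, hμ⟩ := hch1 c hc
    have key := hrow _ (hμ m hm) i
    rw [rowDegrees_add, Finsupp.add_apply] at key
    omega
  have hDsum : ∑ c ∈ C.children P, (C.eval c).totalDegree = D :=
    gammaDrop_sum_totalDegree_children C hP hP0 hPhom hchom
  have hDd : D ≤ d := by
    obtain ⟨m₀, hm₀⟩ := support_nonempty.2 hP0
    have h1 := gammaDrop_degree_eq_of_mem_support hfhom (hext a₀ ha₀ m₀ hm₀)
    have h2 := gammaDrop_degree_eq_of_mem_support hPhom hm₀
    rw [map_add] at h1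
    omega
  -- (1) a support of `P`
  obtain ⟨X, hXk, hfix⟩ := stub_gateSupport C hC hn (by omega : 1 ≤ k) h4k hcard P
  have hX3 : X.card + 3 ≤ n := by omega
  have hX9 : X.card + 9 ≤ n := by omega
  -- (2) the children are invariant under the even permutations fixing `X`
  have hinv : ∀ c ∈ C.children P, ∀ ρ : Equiv.Perm (Fin n), (∀ x ∈ X, ρ x = x) →
      Equiv.Perm.sign ρ = 1 →
      rename (fun x : Fin n × Fin n => (ρ x.1, ρ x.2)) (C.eval c) = C.eval c :=
    fun c hc ρ hρX hρs =>
      gammaDrop_children_invariant C X hX9 hfix hchom (by omega) hc ρ hρX hρs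
  -- (3) the big child
  have hdeg : ∀ c ∈ C.children P, (C.eval c).totalDegree ≤
      ((C.eval c).support.biUnion fun m => (rowDegrees m).support).card := by
    intro c hc
    obtain ⟨m, hm⟩ := support_nonempty.2 (hc0 c hc)
    rw [← gammaDrop_degree_eq_of_mem_support (hchom c hc) hm]
    exact (gamma_degree_eq_card_rows (hcrow c hc m hm)).le.trans
      (Finset.card_le_card (Finset.subset_biUnion_of_mem (fun m => (rowDegrees m).support) hm))
  have hdisj : ∀ c ∈ C.children P, ∀ c' ∈ C.children P, c ≠ c' →
      Disjoint ((C.eval c).support.biUnion fun m => (rowDegrees m).support)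
        ((C.eval c').support.biUnion fun m => (rowDegrees m).support) := by
    intro c hc c' hc' hcc'
    rw [Finset.disjoint_biUnion_left]
    intro m hm
    rw [Finset.disjoint_biUnion_right]
    intro m' hm'
    obtain ⟨μ, hμ⟩ := hch2 c hc c' hc' hcc' m hm m' hm'
    exact gammaDrop_rows_disjoint hrow hμ
  have hfill : ∀ c ∈ C.children P, ∀ i₀ ∉ X,
      i₀ ∈ ((C.eval c).support.biUnion fun m => (rowDegrees m).support) →
      ∀ i ∉ X, i ∈ ((C.eval c).support.biUnion fun m => (rowDegrees m).support) :=
    fun c hc i₀ hi₀X hi₀ i hiX =>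
      gammaDrop_compl_subset_shadow X hX3 (C.eval c) (hinv c hc) hi₀X hi₀ hiX
  obtain ⟨c₀, hc₀, hbig, hothers, hDle⟩ :=
    gammaDrop_big_child (C.children P) C.eval X hXk hkD hDsum hdeg hdisj hfill
  -- (4) the output: `c₀`, the cofactor `q`, `D' = deg (eval c₀)`
  set q : MvPolynomial (Fin n × Fin n) NNReal := ∏ c ∈ (C.children P).erase c₀, C.eval c
    with hq_def
  have hPq : C.eval P = C.eval c₀ * q := by
    rw [C.eval_of_label_mul hP, hq_def,
      Finset.mul_prod_erase (C.children P) (fun x => C.eval x) hc₀]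
  have hq0 : q ≠ 0 := fun h => hP0 (by rw [hPq, h, mul_zero])
  obtain ⟨b₀, hb₀⟩ := support_nonempty.2 hq0
  obtain ⟨m₀, hm₀⟩ := support_nonempty.2 (hc0 c₀ hc₀)
  -- monomials of `Q`, `q`, `eval c₀` multiply to monomials of `f`
  have hkey : ∀ a ∈ Q.support, ∀ b ∈ q.support, ∀ m ∈ (C.eval c₀).support,
      a + b + m ∈ (C.eval (C.output ())).support := by
    intro a ha b hb m hm
    have h1 : m + b ∈ (C.eval P).support := by
      rw [hPq]
      exact add_mem_support_mul hm hb
    have h2 := hext a ha (m + b) h1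
    rwa [add_comm m b, ← add_assoc] at h2
  refine ⟨c₀, q, (C.eval c₀).totalDegree, hc0 c₀ hc₀, hchom c₀ hc₀, by omega, ?_, ?_, ?_⟩
  · -- `Q * q ≠ 0`
    intro h
    have key := add_mem_support_mul ha₀ hb₀
    rw [h, support_zero] at key
    exact Finset.notMem_empty _ key
  · -- the new context extends the monomials of `eval c₀`
    intro a' ha' m hm
    obtain ⟨a, ha, b, hb, rfl⟩ := Finset.mem_add.1 (support_mul Q q ha')
    exact hkey a ha b hb m hm
  · -- shadows
    have hSq : (q.support.biUnion fun m => (rowDegrees m).support) ⊆ X := by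
      apply gammaDrop_shadow_prod_subset
      intro c hc
      exact hothers c (Finset.mem_of_mem_erase hc) (Finset.ne_of_mem_erase hc)
    have hSQ : (Q.support.biUnion fun m => (rowDegrees m).support) ⊆ X := by
      intro i hi
      by_contra hiX
      obtain ⟨a, ha, hia⟩ := Finset.mem_biUnion.1 hi
      obtain ⟨m, hm, him⟩ := Finset.mem_biUnion.1 (hbig i hiX)
      have hd : Disjoint (rowDegrees a).support (rowDegrees m).support := by
        refine gammaDrop_rows_disjoint hrow (m := a) (m' := m) (μ := b₀) ?_
        have key := hkey a ha b₀ hb₀ m hm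
        rwa [add_right_comm] at key
      exact Finset.disjoint_left.1 hd hia him
    have hQq : Disjoint (Q.support.biUnion fun m => (rowDegrees m).support)
        (q.support.biUnion fun m => (rowDegrees m).support) := by
      rw [Finset.disjoint_biUnion_left]
      intro a ha
      rw [Finset.disjoint_biUnion_right]
      intro b hb
      exact gammaDrop_rows_disjoint hrow (hkey a ha b hb m₀ hm₀)
    have hunion : ((Q * q).support.biUnion fun m => (rowDegrees m).support) =
        (Q.support.biUnion fun m => (rowDegrees m).support) ∪
          (q.support.biUnion fun m => (rowDegrees m).support) := by
      refine Finset.Subset.antisymm (gammaDrop_shadow_mul_subset Q q) ?_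
      intro i hi
      rcases Finset.mem_union.1 hi with hi | hi
      · obtain ⟨a, ha, hia⟩ := Finset.mem_biUnion.1 hi
        refine Finset.mem_biUnion.2 ⟨a + b₀, add_mem_support_mul ha hb₀, ?_⟩
        rw [gammaDrop_rows_add]
        exact Finset.mem_union_left _ hia
      · obtain ⟨b, hb, hib⟩ := Finset.mem_biUnion.1 hi
        refine Finset.mem_biUnion.2 ⟨a₀ + b, add_mem_support_mul ha₀ hb, ?_⟩
        rw [gammaDrop_rows_add]
        exact Finset.mem_union_right _ hib
    have hSqne : (q.support.biUnion fun m => (rowDegrees m).support).Nonempty := by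
      have h1 : m₀ + b₀ ∈ (C.eval P).support := by
        rw [hPq]
        exact add_mem_support_mul hm₀ hb₀
      have h2 := gammaDrop_degree_eq_of_mem_support hPhom h1
      have h3 := gammaDrop_degree_eq_of_mem_support (hchom c₀ hc₀) hm₀
      have h4 := hdrop c₀ hc₀
      rw [map_add] at h2
      have hb0 : rowDegrees b₀ ≠ 0 := by
        intro h0
        have key := degree_rowDegrees b₀
        rw [h0, map_zero] at key
        omega
      obtain ⟨i, hi⟩ := Finsupp.support_nonempty_iff.2 hb0
      exact ⟨i, Finset.mem_biUnion.2 ⟨b₀, hb₀, hi⟩⟩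
    rw [hunion, Finset.card_union_of_disjoint hQq]
    constructor
    · have key := hSqne.card_pos
      omega
    · have key := Finset.card_le_card (Finset.union_subset hSQ hSq)
      rw [Finset.card_union_of_disjoint hQq] at key
      omega

end Summit.ValiantsHypothesis.ValiantsHypothesis.Theorems

end
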